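import Summits.Schanuel.Schanuel.Theorems.ZilberEacParamFibreCurveGrowthSub
import HarnessLib

/-!
# Polynomially parametrised base curves, XXXIX: growth of `Re (c R^e + D)` along points
# `t_j = ρ_j ω + τ + o(1)` with `Re R(t_j) = O(log ‖t_j‖)` — the PUISEUX GAP

HONEST FRAMING.  Cell `pub-schanuel` (Zilber's Exponential-Algebraic Closedness, case ladder;
host summit Schanuel), seat 2, gen 21.  The analytic half of the Puiseux-gap theorem (file XL).
Let `R ∈ ℂ[t]` have degree `d`, `c ∈ ℂ`, `e ∈ ℕ` with VANISHING PHASE `Re(c i^e) = 0`, and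
`D ∈ ℂ[t]` of degree `m ≥ d(e-1) + 1` (the GAP) with `Re(lc(D) ω^m) ≠ 0`; let `ρ_j → +∞`,
`t_j - ρ_j ω → τ`, and `|Re R(t_j) - μ log ‖t_j‖| ≤ B` (the value datum of file XXXVIII).  Then
`|Re G(t_j)| / log(2 + ‖G(t_j)‖) → ∞` for `G = c R^e + D` (`tendsto_growth_eval_of_gap`).
Mechanism: `w = R(t_j)` has `|Re w| ≤ |μ| log ‖t_j‖ + B` and `‖w‖ = O(ρ_j^d)`; writing
`w = x + w'` with `w' = i Im w`, `Re(c w'^e) = (Im w)^e Re(c i^e) = 0`, so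
`|Re(c w^e)| ≤ ‖c‖ e ‖w‖^{e-1} |x| = O(ρ_j^{d(e-1)} log ρ_j)` (`abs_re_mul_pow_le_of_phase`),
while `Re D(t_j) = ρ_j^m (Re(lc(D) ω^m) + o(1))`; the gap `m > d(e-1)` and `log ρ = o(ρ)` give
`|Re G(t_j)| ≥ (|Re(lc(D) ω^m)|/2) ρ_j^m` eventually, and `‖G(t_j)‖ = O(ρ_j^N)`.  For
`g₁ = c g₀^e + D` (`d ∣ n`, `e = n/d`, `c = lc(g₁)/lc(g₀)^e`) this covers ALL the intermediate
Puiseux orders `n - d < m < n` of `g₁ ∘ g₀^{-1}` at once (gen 20's sub-leading theorem is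
`m = n - 1`).  Mantova–Masser's question is OPEN in general (PLMS 2024 §1 p. 5); NOT Schanuel's
conjecture (neither used nor implied; EAC ⇏ SC); `EC(3,2)` stays OPEN.
-/

noncomputable section

open Filter Topology Metric Set Complex Polynomial Asymptotics
open Literature.ModelTheory.Zilber
open Literature.Geometry.Symplectic.RotationBranch (norm_pow_sub_pow_le)

set_option linter.dupNamespace false

namespace Summit.Schanuel.Schanuel.Theorems

/-- **Vanishing phase kills the top order near the imaginary axis**: if `Re(c i^e) = 0` then
`|Re(c w^e)| ≤ ‖c‖ · e · ‖w‖^{e-1} · |Re w|` (compare `c w^e` with `c (i Im w)^e`, which is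
`(Im w)^e · c i^e` and has real part `0`). (new) -/
theorem abs_re_mul_pow_le_of_phase {c : ℂ} {e : ℕ} (hph : (c * I ^ e).re = 0) (w : ℂ) :
    |(c * w ^ e).re| ≤ ‖c‖ * e * ‖w‖ ^ (e - 1) * |w.re| := by
  set w' : ℂ := (w.im : ℂ) * I with hw'_def
  have hw' : (c * w' ^ e).re = 0 := by
    have e1 : c * w' ^ e = ((w.im ^ e : ℝ) : ℂ) * (c * I ^ e) := by
      rw [hw'_def, mul_pow]; push_cast; ring
    rw [e1, Complex.re_ofReal_mul, hph, mul_zero]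
  have hdiff : w - w' = (w.re : ℂ) := by
    apply Complex.ext <;> simp [hw'_def]
  have hnw' : ‖w'‖ ≤ ‖w‖ := by
    rw [hw'_def, norm_mul, Complex.norm_I, mul_one, Complex.norm_real, Real.norm_eq_abs]
    exact Complex.abs_im_le_norm w
  have hpow := norm_pow_sub_pow_le (le_refl ‖w‖) hnw' e
  rw [hdiff, Complex.norm_real, Real.norm_eq_abs] at hpow
  calc |(c * w ^ e).re| = |(c * (w ^ e - w' ^ e)).re| := by
        rw [mul_sub, Complex.sub_re, hw', sub_zero]
    _ ≤ ‖c * (w ^ e - w' ^ e)‖ := Complex.abs_re_le_norm _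
    _ = ‖c‖ * ‖w ^ e - w' ^ e‖ := norm_mul _ _
    _ ≤ ‖c‖ * (e * ‖w‖ ^ (e - 1) * |w.re|) := mul_le_mul_of_nonneg_left hpow (norm_nonneg c)
    _ = ‖c‖ * e * ‖w‖ ^ (e - 1) * |w.re| := by ring

/-- **Growth across the Puiseux gap.**  See the module docstring. (new) -/
theorem tendsto_growth_eval_of_gap (R : Polynomial ℂ) (c : ℂ) (e : ℕ)
    (hph : (c * I ^ e).re = 0) (D : Polynomial ℂ)
    (hgap : R.natDegree * (e - 1) + 1 ≤ D.natDegree) (ω τ : ℂ)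
    (hdir : (D.leadingCoeff * ω ^ D.natDegree).re ≠ 0)
    {ρ : ℕ → ℝ} (hρ : Tendsto ρ atTop atTop) {t : ℕ → ℂ}
    (ht : Tendsto (fun j => t j - (ρ j : ℂ) * ω) atTop (𝓝 τ))
    {μ B : ℝ} (hval : ∀ j, |(R.eval (t j)).re - μ * Real.log ‖t j‖| ≤ B) :
    Tendsto (fun j => |((Polynomial.C c * R ^ e + D).eval (t j)).re| /
      Real.log (2 + ‖(Polynomial.C c * R ^ e + D).eval (t j)‖)) atTop atTop := by
  -- degrees and names
  obtain ⟨m, hm⟩ : ∃ m : ℕ, D.natDegree = m + 1 := ⟨D.natDegree - 1, by omega⟩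
  set d : ℕ := R.natDegree with hd_def
  have hgap' : d * (e - 1) ≤ m := by omega
  obtain ⟨G, hG_def⟩ : ∃ G : Polynomial ℂ, G = Polynomial.C c * R ^ e + D := ⟨_, rfl⟩
  rw [← hG_def]
  obtain ⟨b, hb_def⟩ : ∃ b : ℂ, b = D.leadingCoeff := ⟨_, rfl⟩
  obtain ⟨ℓ, hℓ_def⟩ : ∃ ℓ : Polynomial ℂ, ℓ = D.eraseLead := ⟨_, rfl⟩
  have hℓdeg : ℓ.natDegree ≤ m := by
    rw [hℓ_def]; have := Polynomial.eraseLead_natDegree_le D; omega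
  rw [← hb_def, hm] at hdir
  set κ : ℝ := (b * ω ^ (m + 1)).re with hκ_def
  have hκ0 : κ ≠ 0 := hdir
  have hκpos : 0 < |κ| := abs_pos.2 hκ0
  set Y : ℕ → ℂ := fun j => t j - (ρ j : ℂ) * ω with hY_def
  have hY : Tendsto Y atTop (𝓝 τ) := ht
  have hev2 : ∀ᶠ j in atTop, ‖Y j‖ ≤ ‖τ‖ + 1 := by
    have h := hY (Metric.ball_mem_nhds τ one_pos)
    filter_upwards [h] with j hj
    rw [Set.mem_preimage, Metric.mem_ball, dist_eq_norm] at hj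
    have := norm_le_insert' (Y j) τ
    linarith
  -- constants
  set Y₀ : ℝ := ‖τ‖ + 1 with hY₀
  have hY₀0 : 0 ≤ Y₀ := by positivity
  set L : ℝ := ‖ω‖ + Y₀ + 1 with hL
  have hL1 : 1 ≤ L := by rw [hL]; linarith [norm_nonneg ω]
  have hL0 : 0 ≤ L := zero_le_one.trans hL1
  -- `D`-remainder constant
  set KD : ℝ := (‖b‖ * ((m + 1 : ℕ) : ℝ) * Y₀ + coeffNormSum ℓ) * L ^ m with hKD
  have hKD0 : 0 ≤ KD := by have := coeffNormSum_nonneg ℓ; positivity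
  -- `R^e`-part constant
  set KR : ℝ := ‖c‖ * e * (coeffNormSum R * L ^ d) ^ (e - 1) with hKR
  have hKR0 : 0 ≤ KR := by have := coeffNormSum_nonneg R; positivity
  -- the size constant of `G`
  set N : ℕ := G.natDegree + 2 with hN
  set C₁ : ℝ := coeffNormSum G * L ^ N + 1 with hC₁
  have hC₁1 : 1 ≤ C₁ := by
    have h0 : 0 ≤ coeffNormSum G * L ^ N := mul_nonneg (coeffNormSum_nonneg G) (pow_nonneg hL0 N)
    rw [hC₁]; linarith
  have hC₁pos : 0 < C₁ := by linarith
  -- eventual conditions on `ρ`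
  have hωpos : 0 < ‖ω‖ := by
    refine norm_pos_iff.2 fun h0 => hκ0 ?_
    rw [hκ_def, h0, zero_pow (Nat.succ_ne_zero m), mul_zero, Complex.zero_re]
  have hev3 : ∀ᶠ j in atTop, 1 ≤ ρ j := hρ.eventually_ge_atTop 1
  have hev4 : ∀ᶠ j in atTop, 4 * KD / |κ| ≤ ρ j := hρ.eventually_ge_atTop _
  have hev6 : ∀ᶠ j in atTop, (Y₀ + 1) / ‖ω‖ ≤ ρ j := hρ.eventually_ge_atTop _
  -- `log ρ = o(ρ)`: eventually `KR (|μ| (log ρ + log L) + |B|) ≤ (|κ|/4) ρ`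
  have hev5 : ∀ᶠ j in atTop,
      KR * (|μ| * (Real.log (ρ j) + Real.log L) + |B|) ≤ |κ| / 4 * ρ j := by
    have hε : 0 < |κ| / 8 / (KR * |μ| + 1) := by positivity
    have h1 : ∀ᶠ x : ℝ in atTop, ‖Real.log x‖ ≤ |κ| / 8 / (KR * |μ| + 1) * ‖x‖ :=
      Real.isLittleO_log_id_atTop.bound hε
    have h2 : ∀ᶠ j in atTop, ‖Real.log (ρ j)‖ ≤ |κ| / 8 / (KR * |μ| + 1) * ‖ρ j‖ :=
      hρ.eventually h1
    have h3 : ∀ᶠ j in atTop, 8 * (KR * (|μ| * Real.log L + |B|)) / |κ| ≤ ρ j :=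
      hρ.eventually_ge_atTop _
    filter_upwards [h2, h3, hev3] with j hj h3j h1j
    have hρ0 : 0 ≤ ρ j := zero_le_one.trans h1j
    rw [Real.norm_eq_abs, Real.norm_eq_abs, abs_of_nonneg hρ0] at hj
    have hlog0 : 0 ≤ Real.log (ρ j) := Real.log_nonneg h1j
    rw [abs_of_nonneg hlog0] at hj
    have hA : KR * |μ| * Real.log (ρ j) ≤ |κ| / 8 * ρ j := by
      have hKμ : 0 ≤ KR * |μ| := by positivity
      have hKμ1 : 0 < KR * |μ| + 1 := by positivity
      calc KR * |μ| * Real.log (ρ j) ≤ KR * |μ| * (|κ| / 8 / (KR * |μ| + 1) * ρ j) :=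
            mul_le_mul_of_nonneg_left hj hKμ
        _ = (KR * |μ| / (KR * |μ| + 1)) * (|κ| / 8 * ρ j) := by
            field_simp
        _ ≤ 1 * (|κ| / 8 * ρ j) := by
            refine mul_le_mul_of_nonneg_right ?_ (by positivity)
            rw [div_le_one hKμ1]; linarith
        _ = |κ| / 8 * ρ j := one_mul _
    have hB' : KR * (|μ| * Real.log L + |B|) ≤ |κ| / 8 * ρ j := by
      rw [div_le_iff₀ hκpos] at h3j
      linarith
    calc KR * (|μ| * (Real.log (ρ j) + Real.log L) + |B|)
        = KR * |μ| * Real.log (ρ j) + KR * (|μ| * Real.log L + |B|) := by ring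
      _ ≤ |κ| / 8 * ρ j + |κ| / 8 * ρ j := add_le_add hA hB'
      _ = |κ| / 4 * ρ j := by ring
  -- evaluation of `G`
  have hGeval : ∀ z : ℂ, G.eval z = c * (R.eval z) ^ e + D.eval z := fun z => by
    rw [hG_def, Polynomial.eval_add, Polynomial.eval_mul, Polynomial.eval_C, Polynomial.eval_pow]
  -- the pointwise estimate
  have hpt : ∀ j, 1 ≤ ρ j → 4 * KD / |κ| ≤ ρ j →
      KR * (|μ| * (Real.log (ρ j) + Real.log L) + |B|) ≤ |κ| / 4 * ρ j →
      (Y₀ + 1) / ‖ω‖ ≤ ρ j → ‖Y j‖ ≤ Y₀ →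
      |κ| / 2 * ρ j ^ (m + 1) ≤ |(G.eval (t j)).re| ∧ ‖G.eval (t j)‖ ≤ C₁ * ρ j ^ N := by
    intro j h1 h4 h5 h6 h2
    have hρ0 : 0 ≤ ρ j := zero_le_one.trans h1
    have hρpos : 0 < ρ j := zero_lt_one.trans_le h1
    set X : ℂ := (ρ j : ℂ) * ω with hX_def
    have htXY : t j = X + Y j := by rw [hY_def, hX_def]; ring
    have hXnorm : ‖X‖ = ρ j * ‖ω‖ := by
      rw [hX_def, norm_mul, Complex.norm_real, Real.norm_eq_abs, abs_of_nonneg hρ0]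
    set M : ℝ := ρ j * L with hM_def
    have hM1 : 1 ≤ M := one_le_mul_of_one_le_of_one_le h1 hL1
    have hM0 : 0 ≤ M := zero_le_one.trans hM1
    have hXM : ‖X‖ ≤ M := by
      rw [hXnorm, hM_def]
      exact mul_le_mul_of_nonneg_left (by rw [hL]; linarith) hρ0
    have htM : ‖t j‖ ≤ M := by
      rw [htXY]
      calc ‖X + Y j‖ ≤ ‖X‖ + ‖Y j‖ := norm_add_le _ _
        _ ≤ ρ j * ‖ω‖ + Y₀ := by rw [hXnorm]; linarith
        _ ≤ ρ j * ‖ω‖ + ρ j * Y₀ + ρ j * 1 := by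
            have hY1 : Y₀ ≤ ρ j * Y₀ := le_mul_of_one_le_left hY₀0 h1
            linarith
        _ = M := by rw [hM_def, hL]; ring
    have ht1 : 1 ≤ ‖t j‖ := by
      have hlow : ‖X‖ - ‖Y j‖ ≤ ‖t j‖ := by
        rw [htXY]; exact norm_sub_le_norm_add _ _
      have h6' : Y₀ + 1 ≤ ρ j * ‖ω‖ := by rwa [div_le_iff₀ hωpos] at h6
      rw [hXnorm] at hlow
      linarith
    have htpos : 0 < ‖t j‖ := zero_lt_one.trans_le ht1
    have hlogt0 : 0 ≤ Real.log ‖t j‖ := Real.log_nonneg ht1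
    have hlogt : Real.log ‖t j‖ ≤ Real.log (ρ j) + Real.log L := by
      rw [← Real.log_mul hρpos.ne' (by linarith)]
      exact Real.log_le_log htpos htM
    -- (1) the `D`-part
    have hDdec : D.eval (t j) =
        b * X ^ (m + 1) + (b * (t j ^ (m + 1) - X ^ (m + 1)) + ℓ.eval (t j)) := by
      rw [eval_eq_eraseLead_add D, ← hℓ_def, ← hb_def, hm]; ring
    have hR₂ := norm_pow_sub_pow_le htM hXM (m + 1)
    simp only [Nat.add_sub_cancel] at hR₂
    rw [show t j - X = Y j by rw [htXY]; ring] at hR₂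
    have hℓn : ‖ℓ.eval (t j)‖ ≤ coeffNormSum ℓ * M ^ m :=
      norm_eval_le_of_natDegree_le ℓ hM1 htM hℓdeg
    have hDjunk : ‖b * (t j ^ (m + 1) - X ^ (m + 1)) + ℓ.eval (t j)‖ ≤ KD * ρ j ^ m := by
      have hMm : M ^ m = ρ j ^ m * L ^ m := by rw [hM_def, mul_pow]
      have h1' : ‖b * (t j ^ (m + 1) - X ^ (m + 1))‖ ≤
          ‖b‖ * (((m + 1 : ℕ) : ℝ) * M ^ m * Y₀) := by
        rw [norm_mul]
        refine mul_le_mul_of_nonneg_left (hR₂.trans ?_) (norm_nonneg b)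
        push_cast
        exact mul_le_mul_of_nonneg_left h2 (by positivity)
      calc ‖b * (t j ^ (m + 1) - X ^ (m + 1)) + ℓ.eval (t j)‖
          ≤ ‖b * (t j ^ (m + 1) - X ^ (m + 1))‖ + ‖ℓ.eval (t j)‖ := norm_add_le _ _
        _ ≤ ‖b‖ * (((m + 1 : ℕ) : ℝ) * M ^ m * Y₀) + coeffNormSum ℓ * M ^ m :=
            add_le_add h1' hℓn
        _ = KD * ρ j ^ m := by rw [hKD, hMm]; push_cast; ring
    have hXpow : X ^ (m + 1) = ((ρ j ^ (m + 1) : ℝ) : ℂ) * ω ^ (m + 1) := by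
      rw [hX_def, mul_pow]; push_cast; ring
    have hreD1 : (b * X ^ (m + 1)).re = κ * ρ j ^ (m + 1) := by
      rw [hXpow, show b * (((ρ j ^ (m + 1) : ℝ) : ℂ) * ω ^ (m + 1)) =
        (b * ω ^ (m + 1)) * ((ρ j ^ (m + 1) : ℝ) : ℂ) by ring, Complex.re_mul_ofReal]
    have hreD : |(D.eval (t j)).re - κ * ρ j ^ (m + 1)| ≤ KD * ρ j ^ m := by
      rw [hDdec, Complex.add_re, hreD1, add_sub_cancel_left]
      exact (Complex.abs_re_le_norm _).trans hDjunk
    -- (2) the `R^e`-part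
    set w : ℂ := R.eval (t j) with hw_def
    have hwn : ‖w‖ ≤ coeffNormSum R * M ^ d := norm_eval_le_of_natDegree_le R hM1 htM le_rfl
    have hwre : |w.re| ≤ |μ| * (Real.log (ρ j) + Real.log L) + |B| := by
      have hv := hval j
      rw [← hw_def] at hv
      have h1' : |w.re| ≤ |μ * Real.log ‖t j‖| + B := by
        have := abs_sub_abs_le_abs_sub w.re (μ * Real.log ‖t j‖)
        linarith
      rw [abs_mul, abs_of_nonneg hlogt0] at h1'
      calc |w.re| ≤ |μ| * Real.log ‖t j‖ + B := h1'
        _ ≤ |μ| * (Real.log (ρ j) + Real.log L) + |B| :=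
            add_le_add (mul_le_mul_of_nonneg_left hlogt (abs_nonneg μ)) (le_abs_self B)
    have hReCw : |(c * w ^ e).re| ≤ |κ| / 4 * ρ j ^ (m + 1) := by
      have h0 := abs_re_mul_pow_le_of_phase hph w
      have hwpow : ‖w‖ ^ (e - 1) ≤ (coeffNormSum R * L ^ d) ^ (e - 1) * ρ j ^ (d * (e - 1)) := by
        calc ‖w‖ ^ (e - 1) ≤ (coeffNormSum R * M ^ d) ^ (e - 1) :=
              pow_le_pow_left₀ (norm_nonneg _) hwn _
          _ = (coeffNormSum R * L ^ d) ^ (e - 1) * ρ j ^ (d * (e - 1)) := by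
              rw [hM_def, mul_pow, pow_mul]; ring
      have hce : 0 ≤ ‖c‖ * e := by positivity
      have hstep : ‖c‖ * e * ‖w‖ ^ (e - 1) * |w.re| ≤
          KR * ρ j ^ (d * (e - 1)) * (|μ| * (Real.log (ρ j) + Real.log L) + |B|) := by
        have := mul_le_mul (mul_le_mul_of_nonneg_left hwpow hce) hwre (abs_nonneg _)
          (by have := coeffNormSum_nonneg R; positivity)
        calc ‖c‖ * e * ‖w‖ ^ (e - 1) * |w.re|
            ≤ ‖c‖ * e * ((coeffNormSum R * L ^ d) ^ (e - 1) * ρ j ^ (d * (e - 1))) *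
              (|μ| * (Real.log (ρ j) + Real.log L) + |B|) := this
          _ = KR * ρ j ^ (d * (e - 1)) * (|μ| * (Real.log (ρ j) + Real.log L) + |B|) := by
              rw [hKR]; ring
      have hstep2 : KR * ρ j ^ (d * (e - 1)) * (|μ| * (Real.log (ρ j) + Real.log L) + |B|) ≤
          |κ| / 4 * ρ j ^ (m + 1) := by
        have hpow' : ρ j ^ (d * (e - 1)) * ρ j ≤ ρ j ^ (m + 1) := by
          rw [← pow_succ]
          exact pow_le_pow_right₀ h1 (by omega)
        calc KR * ρ j ^ (d * (e - 1)) * (|μ| * (Real.log (ρ j) + Real.log L) + |B|)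
            = ρ j ^ (d * (e - 1)) * (KR * (|μ| * (Real.log (ρ j) + Real.log L) + |B|)) := by ring
          _ ≤ ρ j ^ (d * (e - 1)) * (|κ| / 4 * ρ j) :=
              mul_le_mul_of_nonneg_left h5 (by positivity)
          _ = |κ| / 4 * (ρ j ^ (d * (e - 1)) * ρ j) := by ring
          _ ≤ |κ| / 4 * ρ j ^ (m + 1) := mul_le_mul_of_nonneg_left hpow' (by positivity)
      exact h0.trans (hstep.trans hstep2)
    -- (3) assemble the real part
    have hKρ : KD * ρ j ^ m ≤ |κ| / 4 * ρ j ^ (m + 1) := by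
      have h4' : KD ≤ |κ| / 4 * ρ j := by
        rw [div_le_iff₀ hκpos] at h4
        linarith
      calc KD * ρ j ^ m ≤ (|κ| / 4 * ρ j) * ρ j ^ m :=
            mul_le_mul_of_nonneg_right h4' (by positivity)
        _ = |κ| / 4 * ρ j ^ (m + 1) := by ring
    have hreG : (G.eval (t j)).re = (c * w ^ e).re + (D.eval (t j)).re := by
      rw [hGeval, Complex.add_re]
    refine ⟨?_, ?_⟩
    · rw [hreG]
      have hmain : |κ| * ρ j ^ (m + 1) = |κ * ρ j ^ (m + 1)| := by
        rw [abs_mul, abs_of_nonneg (by positivity : (0 : ℝ) ≤ ρ j ^ (m + 1))]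
      have e1 : (c * w ^ e).re + (D.eval (t j)).re =
          κ * ρ j ^ (m + 1) + (((D.eval (t j)).re - κ * ρ j ^ (m + 1)) + (c * w ^ e).re) := by
        ring
      rw [e1]
      have htri := abs_sub_abs_le_abs_sub (κ * ρ j ^ (m + 1))
        (-(((D.eval (t j)).re - κ * ρ j ^ (m + 1)) + (c * w ^ e).re))
      rw [sub_neg_eq_add, abs_neg] at htri
      have hsum : |((D.eval (t j)).re - κ * ρ j ^ (m + 1)) + (c * w ^ e).re| ≤
          |κ| / 4 * ρ j ^ (m + 1) + |κ| / 4 * ρ j ^ (m + 1) :=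
        (abs_add_le _ _).trans (add_le_add (hreD.trans hKρ) hReCw)
      rw [← hmain] at htri
      linarith
    · calc ‖G.eval (t j)‖ ≤ coeffNormSum G * M ^ N :=
            norm_eval_le_of_natDegree_le G hM1 htM (by rw [hN]; omega)
        _ = coeffNormSum G * L ^ N * ρ j ^ N := by rw [hM_def, mul_pow]; ring
        _ ≤ C₁ * ρ j ^ N := by
            refine mul_le_mul_of_nonneg_right ?_ (by positivity)
            rw [hC₁]; linarith
  -- the comparison function
  have hcmp : Tendsto (fun j => |κ| / (2 * (N : ℝ)) * (ρ j / Real.log (2 + C₁ * ρ j)))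
      atTop atTop :=
    ((gce_tendsto_div_log_affine (by norm_num : (1 : ℝ) < 2) hC₁pos).comp hρ).const_mul_atTop
      (by positivity)
  refine tendsto_atTop_mono' atTop ?_ hcmp
  filter_upwards [hev2, hev3, hev4, hev5, hev6] with j h2 h1 h4 h5 h6
  obtain ⟨hlow, hup⟩ := hpt j h1 h4 h5 h6 h2
  have hρ0 : 0 ≤ ρ j := zero_le_one.trans h1
  have hNpos : (0 : ℝ) < (N : ℝ) := by positivity
  have hC₁ρ : 0 ≤ C₁ * ρ j := mul_nonneg hC₁pos.le hρ0
  have harg : 1 < 2 + C₁ * ρ j := by linarith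
  have hlogpos : 0 < Real.log (2 + C₁ * ρ j) := Real.log_pos harg
  have hlogpos' : 0 < Real.log (2 + ‖G.eval (t j)‖) :=
    Real.log_pos (by linarith [norm_nonneg (G.eval (t j))])
  have hlog1 : Real.log (2 + ‖G.eval (t j)‖) ≤ (N : ℝ) * Real.log (2 + C₁ * ρ j) := by
    rw [← Real.log_pow]
    refine Real.log_le_log (by linarith [norm_nonneg (G.eval (t j))]) ?_
    calc 2 + ‖G.eval (t j)‖ ≤ 2 + C₁ * ρ j ^ N := by linarith
      _ ≤ (2 + C₁ * ρ j) ^ N := two_add_mul_pow_le_pow hC₁1 hρ0 G.natDegree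
  have hρpow : ρ j ≤ ρ j ^ (m + 1) := by
    calc ρ j = ρ j ^ 1 := (pow_one _).symm
      _ ≤ ρ j ^ (m + 1) := pow_le_pow_right₀ h1 (by omega)
  calc |κ| / (2 * (N : ℝ)) * (ρ j / Real.log (2 + C₁ * ρ j))
      = (|κ| / 2 * ρ j) / ((N : ℝ) * Real.log (2 + C₁ * ρ j)) := by
        field_simp
    _ ≤ (|κ| / 2 * ρ j ^ (m + 1)) / ((N : ℝ) * Real.log (2 + C₁ * ρ j)) :=
        div_le_div_of_nonneg_right (mul_le_mul_of_nonneg_left hρpow (by positivity))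
          (by positivity)
    _ ≤ |(G.eval (t j)).re| / ((N : ℝ) * Real.log (2 + C₁ * ρ j)) :=
        div_le_div_of_nonneg_right hlow (by positivity)
    _ ≤ |(G.eval (t j)).re| / Real.log (2 + ‖G.eval (t j)‖) :=
        div_le_div_of_nonneg_left (abs_nonneg _) hlogpos' hlog1

end Summit.Schanuel.Schanuel.Theorems
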